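import Literature.Barriers.NavierStokesRegularity.NavierStokesInequalityCantorArrangementProofs
import Literature.Barriers.NavierStokesRegularity.NavierStokesInequalityStructureRecipeRing
import HarnessLib

/-!
# Fact C′ discharged: the geometric arrangement for Theorem 14 exists (Ożański 2017, §6.5)

Barrier catalogue support file for `NavierStokesRegularity` (D-0021): the discharge
`NSICantorArrangementExists_holds` of fact C′
`Literature.Barriers.NavierStokesRegularity.NSICantorArrangementExists` of
`NavierStokesInequalityCantorArrangement` (W. S. Ożański, arXiv:1709.00602v4, §6.5 Steps 1–6 over
§5; V. Scheffer, Comm. Math. Phys. 110 (1987), §4), obtained by feeding the two proved cut-off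
facts of Theorem 3.4 — `Ozanski2017_cutoff_rect_holds` (`NavierStokesInequalityStructureRecipeProofs`)
and `Ozanski2017_cutoff_ring_holds` (`NavierStokesInequalityStructureRecipeRing`) — to the
assembly `nsiCantorArrangementExists_of_cutoffs` of `NavierStokesInequalityCantorArrangementProofs`
(bricks: `…StructureCopies`, `…RingField`, `…InteractionStack`, `…CantorBackground`,
`…InteractionDecay`, `…StructureRecipe`). With it, fact B′ `NSICantorBlockExists` (the Cantor
block) follows from fact D′ `NSICantorBlock_of_arrangement` alone
(`nsiCantorBlockExists_of_block_of_arrangement`).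

## References

* W. S. Ożański, arXiv:1709.00602v4 (2017/2019), §6.5 (Steps 1–6, Lemma 6.18, (6.33)–(6.36)),
  §5 (Lemmas 5.2–5.3, §5.5), §3 (Thm. 3.4, Lemma 3.5), App. A. [`Ozanski2017NSISingular`]
* V. Scheffer, Comm. Math. Phys. 110 (1987), 525–551, §4 (Lemmas 4.1–4.18), §5 ((5.1)–(5.7),
  (5.19)–(5.25)). [`Scheffer1987`]
-/

noncomputable section

namespace Literature.Barriers.NavierStokesRegularity

/-- **Fact C′ (Ożański 2017, §6.5; Scheffer 1987, §4): for every `ξ ∈ (0,1)` there is a geometric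
arrangement for Theorem 14 with `τ^ξ M ≥ 1`.** The discharge of `NSICantorArrangementExists`:
the assembly `nsiCantorArrangementExists_of_cutoffs` applied to the proved cut-off facts of
Theorem 3.4. [cite: Ozanski2017NSISingular, §6.5 Steps 1–6] [cite: Scheffer1987, §4 (Lemmas 4.1–4.18)] -/
theorem NSICantorArrangementExists_holds : NSICantorArrangementExists :=
  nsiCantorArrangementExists_of_cutoffs Ozanski2017_cutoff_rect_holds Ozanski2017_cutoff_ring_holds

/-- **Fact B′ from fact D′ alone**: with C′ proved, the Cantor block `NSICantorBlockExists` follows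
from `NSICantorBlock_of_arrangement` (Ożański 2017, §6.2: "We now show how Theorem 14 follows
(given the geometric arrangement)"). [cite: Ozanski2017NSISingular, §6.2 p. 28] -/
theorem nsiCantorBlockExists_of_block_of_arrangement (hD : NSICantorBlock_of_arrangement) :
    NSICantorBlockExists :=
  nsiCantorBlockExists_of_arrangement NSICantorArrangementExists_holds hD

end Literature.Barriers.NavierStokesRegularity
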